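import Literature.MathematicalPhysics.KineticTheory.FouriersLaw
import HarnessLib

/-!
# The Kac-range oscillator chain between two Langevin baths

Topic `Literature/MathematicalPhysics/KineticTheory` (definition item `defn-KacOscillatorChain`, for
route `AtomisticToContinuum/KacRangeDichotomy`: informal cruxes KacConductivityScaling,
TwoChannelKineticLimit, LatticeVlasovLimit). Sibling of `FouriersLaw.lean`, whose conventions
(`PhaseSpace N`, `partialQ`/`partialP`, weak stationarity, the BLR (33) shape of Fourier's law) are
reused verbatim.

The model (Campa–Dauxois–Fanelli–Ruffo, *Physics of Long-Range Interacting Systems* (2014), §8.5,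
Kac scaling; Bachelard et al. 2011; Iubini et al. 2018 for long-range chains between reservoirs):
`N` unit-mass oscillators with pinning `U`, pair interaction `V` weighted by a **Kac kernel**
`R⁻¹ φ((i − j)/R)` of range `R` (`φ` even, `≥ 0`, compactly supported), Hamiltonian
`H_R(q,p) = Σ_i (p_i²/2 + U(q_i)) + ½ Σ_{i ≠ j} R⁻¹ φ((i−j)/R) V(q_j − q_i)`,
coupled at sites `0` and `N − 1` to Ornstein–Uhlenbeck heat baths at temperatures `T_L`, `T_R`
with friction `γ` — the SAME bath terms as `OscillatorChain.generator`
(Bonetto–Lebowitz–Rey-Bellet 2000, §4.1 (10)). The energy flux through the cut between sites `c`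
and `c + 1` is `J_c = Σ_{i ≤ c < j} R⁻¹φ((i−j)/R) · (−½)(p_i + p_j) V′(q_j − q_i)` (BLR §5.2 (23)
bond current, summed over the bonds crossing the cut).

* `KacOscillatorChain` — data `(U, V, γ, φ, R)`; `IsKacKernel φ` — the standing conditions on `φ`.
* `kacWeight K i j = R⁻¹ φ((i − j)/R)`; `hamiltonian`, `generator`, `cutCurrent`, `totalCutCurrent`,
  `IsSteadyState`, `FouriersLawFor` (verbatim the BLR (33) shape of `OscillatorChain.FouriersLawFor`
  with `totalCutCurrent`).
* `kacPinnedChain ω₂ lam β γ φ R` — `U = ω₂q²/2 + lam q⁴/4`, `V = r²/2 + βr⁴/4`.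
* Calibration at range `R = 1` (proved): for a kernel with `φ(1) = φ(−1) = 1` and `φ(z) = 0` at the
  other nonzero integers, and an EVEN interaction `V`, the Kac Hamiltonian, generator and cut
  currents are those of the nearest-neighbour `OscillatorChain` with the same `(U, V, γ)`
  (`hamiltonian_eq_of_range_one`, `generator_eq_of_range_one`, `cutCurrent_eq_bondCurrent_of_range_one`),
  in particular for `kacPinnedChain … φ 1` versus `pinnedChain` (whose `V` is even), so
  `FouriersLawFor` transfers both ways at `R = 1` (`fouriersLawFor_kacPinnedChain_one_iff`).
-/

noncomputable section

open MeasureTheory Filter Topology Finset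
open scoped ContDiff

namespace Literature.MathematicalPhysics.KineticTheory.HeatConduction

/-- The data of a **Kac-range oscillator chain** between Langevin baths: pinning potential `U`,
pair potential `V`, bath friction `γ`, range kernel `φ` and range `R`.
[cite: CampaEtAl2014, §8.5 (Kac scaling of long-range lattices)] [cite: BonettoLebowitzReyBellet2000, §3 eq. (8) and §4.1 eq. (10)] -/
structure KacOscillatorChain where
  /-- the pinning (on-site) potential `U` -/
  U : ℝ → ℝ
  /-- the pair interaction potential `V` -/
  V : ℝ → ℝ
  /-- the coupling constant `γ` of the Langevin baths -/
  γ : ℝ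
  /-- the Kac range kernel `φ` -/
  φ : ℝ → ℝ
  /-- the interaction range `R` -/
  R : ℕ

/-- The standing conditions on a Kac kernel: even, non-negative, compactly supported, and range
`R ≥ 1`. [cite: CampaEtAl2014, §8.5] -/
def KacOscillatorChain.IsKacKernel (K : KacOscillatorChain) : Prop :=
  (∀ z, K.φ (-z) = K.φ z) ∧ (∀ z, 0 ≤ K.φ z) ∧ HasCompactSupport K.φ ∧ 1 ≤ K.R

namespace KacOscillatorChain

variable (K : KacOscillatorChain)

/-- The Kac weight of the pair `(i, j)`: `R⁻¹ φ((i − j)/R)`. [cite: CampaEtAl2014, §8.5] -/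
def kacWeight {N : ℕ} (i j : Fin N) : ℝ :=
  (K.R : ℝ)⁻¹ * K.φ (((i : ℝ) - (j : ℝ)) / K.R)

/-- The Kac Hamiltonian
`H_R(q,p) = Σ_i (p_i²/2 + U(q_i)) + ½ Σ_{i ≠ j} R⁻¹ φ((i−j)/R) V(q_j − q_i)`.
[cite: CampaEtAl2014, §8.5] [cite: BonettoLebowitzReyBellet2000, §3 eq. (8)] -/
def hamiltonian (N : ℕ) (x : PhaseSpace N) : ℝ :=
  (∑ i, (x.2 i ^ 2 / 2 + K.U (x.1 i))) +
    (1 / 2 : ℝ) * ∑ i : Fin N, ∑ j : Fin N, if i ≠ j then K.kacWeight i j * K.V (x.1 j - x.1 i) else 0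

/-- The generator: Hamiltonian vector field of `H_R` plus the two Ornstein–Uhlenbeck bath terms of
`OscillatorChain.generator` (temperature `T_L` at site `0`, `T_R` at site `N − 1`, friction `γ`).
[cite: BonettoLebowitzReyBellet2000, §4.1 eq. (10)] -/
def generator (N : ℕ) (T_L T_R : ℝ) (f : PhaseSpace N → ℝ) (x : PhaseSpace N) : ℝ :=
  (∑ i, (x.2 i * partialQ i f x - partialQ i (K.hamiltonian N) x * partialP i f x)) +
    K.γ * ∑ i : Fin N,
      ((if i.val = 0 then T_L * partialP i (partialP i f) x - x.2 i * partialP i f x else 0) +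
        (if i.val = N - 1 then T_R * partialP i (partialP i f) x - x.2 i * partialP i f x else 0))

/-- The energy flux through the cut between sites `c` and `c + 1`:
`J_c = Σ_{i ≤ c < j} R⁻¹φ((i−j)/R) · (−½)(p_i + p_j) V′(q_j − q_i)`.
[cite: BonettoLebowitzReyBellet2000, §5.2 eq. (23) (bond currents, summed over the cut)] -/
def cutCurrent (N : ℕ) (c : Fin N) (x : PhaseSpace N) : ℝ :=
  ∑ i : Fin N, ∑ j : Fin N, if i.val ≤ c.val ∧ c.val < j.val then
    K.kacWeight i j * (-((x.2 i + x.2 j) / 2 * deriv K.V (x.1 j - x.1 i))) else 0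

/-- The cut-summed steady energy flux `Σ_c ∫ J_c dμ`. [cite: BonettoLebowitzReyBellet2000, §1 and §5.2] -/
def totalCutCurrent {N : ℕ} (μ : Measure (PhaseSpace N)) : ℝ :=
  ∑ c : Fin N, ∫ x, K.cutCurrent N c x ∂μ

/-- Steady state of the Kac chain between baths at `T_L, T_R`: probability measure, weak
stationarity `∫ L f dμ = 0` for smooth compactly supported `f`, cut currents integrable
(verbatim the shape of `OscillatorChain.IsSteadyState`). [cite: BonettoLebowitzReyBellet2000, §5.1] -/
def IsSteadyState (N : ℕ) (T_L T_R : ℝ) (μ : Measure (PhaseSpace N)) : Prop :=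
  IsProbabilityMeasure μ ∧
    (∀ f : PhaseSpace N → ℝ, ContDiff ℝ ∞ f → HasCompactSupport f →
      ∫ x, K.generator N T_L T_R f x ∂μ = 0) ∧
    ∀ c : Fin N, Integrable (K.cutCurrent N c) μ

/-- **Fourier's law for the Kac chain `K`** — verbatim the Bonetto–Lebowitz–Rey-Bellet (33) shape of
`OscillatorChain.FouriersLawFor`, with `totalCutCurrent`. [cite: BonettoLebowitzReyBellet2000, §5.3 eq. (33)] -/
def FouriersLawFor (K : KacOscillatorChain) : Prop :=
  (∀ (N : ℕ) (T_L T_R : ℝ), 0 < T_L → 0 < T_R →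
      ∃ μ : Measure (PhaseSpace N), K.IsSteadyState N T_L T_R μ ∧
        ∀ ν : Measure (PhaseSpace N), K.IsSteadyState N T_L T_R ν → ν = μ) ∧
  ∃ κ : ℝ → ℝ, (∀ T, 0 < T → 0 < κ T) ∧
    ∀ μ : (N : ℕ) → ℝ → ℝ → Measure (PhaseSpace N),
      (∀ (N : ℕ) (T_L T_R : ℝ), 0 < T_L → 0 < T_R → K.IsSteadyState N T_L T_R (μ N T_L T_R)) →
      ∀ T : ℝ, 0 < T →
        ∃ D : ℕ → ℝ,
          (∀ N : ℕ, Tendsto (fun δ : ℝ => K.totalCutCurrent (μ N (T + δ / 2) (T - δ / 2)) / δ)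
            (𝓝[≠] 0) (𝓝 (D N))) ∧
          Tendsto D atTop (𝓝 (κ T))

/-- The nearest-neighbour chain with the same `(U, V, γ)`. [folklore] -/
def toOscillatorChain : OscillatorChain where
  U := K.U
  V := K.V
  γ := K.γ

end KacOscillatorChain

/-- The **Kac pinned anharmonic chain**: `U = ω₂q²/2 + lam q⁴/4`, `V = r²/2 + βr⁴/4`, friction `γ`,
kernel `φ`, range `R` (the long-range version of `pinnedChain`). [cite: CampaEtAl2014, §8.5] [cite: BonettoLebowitzReyBellet2000, §3 eq. (8) and §10 item 1] -/
def kacPinnedChain (ω₂ lam β γ : ℝ) (φ : ℝ → ℝ) (R : ℕ) : KacOscillatorChain where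
  U q := ω₂ * q ^ 2 / 2 + lam * q ^ 4 / 4
  V r := r ^ 2 / 2 + β * r ^ 4 / 4
  γ := γ
  φ := φ
  R := R

/-- `kacPinnedChain` has the `(U, V, γ)` of `pinnedChain`. [folklore] -/
@[simp] theorem kacPinnedChain_toOscillatorChain (ω₂ lam β γ : ℝ) (φ : ℝ → ℝ) (R : ℕ) :
    (kacPinnedChain ω₂ lam β γ φ R).toOscillatorChain = pinnedChain ω₂ lam β γ := rfl

/-! ### Calibration at range `R = 1` -/

namespace KacOscillatorChain

/-- A **nearest-neighbour kernel at range one**: `R = 1`, `φ(±1) = 1`, and `φ` vanishes at every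
other nonzero integer. [folklore] -/
def IsNearestNeighbourAtRangeOne (K : KacOscillatorChain) : Prop :=
  K.R = 1 ∧ K.φ 1 = 1 ∧ K.φ (-1) = 1 ∧ ∀ z : ℤ, z ≠ 0 → z ≠ 1 → z ≠ -1 → K.φ z = 0

variable {K : KacOscillatorChain}

/-- At range one with a nearest-neighbour kernel, the Kac weight of a pair `i ≠ j` is the
indicator of `|i − j| = 1`. [folklore] -/
theorem kacWeight_of_range_one (h : K.IsNearestNeighbourAtRangeOne) {N : ℕ} {i j : Fin N}
    (hne : i ≠ j) :
    K.kacWeight i j = if j.val = i.val + 1 ∨ i.val = j.val + 1 then 1 else 0 := by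
  obtain ⟨hR, h1, hm1, h0⟩ := h
  have hne' : i.val ≠ j.val := fun e => hne (Fin.ext e)
  unfold kacWeight
  rw [hR]
  simp only [Nat.cast_one, inv_one, div_one, one_mul]
  have hcast : ((i : ℝ) - (j : ℝ)) = (((i.val : ℤ) - (j.val : ℤ) : ℤ) : ℝ) := by push_cast; ring
  rw [hcast]
  split_ifs with hij
  · rcases hij with hij | hij
    · have e : ((i.val : ℤ) - (j.val : ℤ)) = -1 := by omega
      rw [e]; exact_mod_cast hm1
    · have e : ((i.val : ℤ) - (j.val : ℤ)) = 1 := by omega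
      rw [e]; exact_mod_cast h1
  · simp only [not_or] at hij
    exact h0 _ (by omega) (by omega) (by omega)

/-- **Calibration of the Hamiltonian at range one**: for a nearest-neighbour kernel and an EVEN
interaction `V`, the Kac Hamiltonian is the nearest-neighbour Hamiltonian of `FouriersLaw.lean`
with the same `(U, V, γ)`. [folklore] -/
theorem hamiltonian_eq_of_range_one (h : K.IsNearestNeighbourAtRangeOne)
    (hV : ∀ r, K.V (-r) = K.V r) (N : ℕ) (x : PhaseSpace N) :
    K.hamiltonian N x = K.toOscillatorChain.hamiltonian N x := by
  unfold hamiltonian OscillatorChain.hamiltonian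
  simp only [toOscillatorChain]
  congr 1
  have key : ∀ i j : Fin N, (if i ≠ j then K.kacWeight i j * K.V (x.1 j - x.1 i) else 0) =
      (if j.val = i.val + 1 then K.V (x.1 j - x.1 i) else 0) +
        (if i.val = j.val + 1 then K.V (x.1 j - x.1 i) else 0) := by
    intro i j
    by_cases hne : i = j
    · subst hne
      simp
    · rw [if_pos hne, kacWeight_of_range_one h hne]
      have hne' : i.val ≠ j.val := fun e => hne (Fin.ext e)
      by_cases h1 : j.val = i.val + 1
      · have h2 : ¬ i.val = j.val + 1 := by omega
        rw [if_pos (Or.inl h1), if_pos h1, if_neg h2]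
        ring
      · by_cases h2 : i.val = j.val + 1
        · rw [if_pos (Or.inr h2), if_neg h1, if_pos h2]
          ring
        · have h3 : ¬ (j.val = i.val + 1 ∨ i.val = j.val + 1) := by omega
          rw [if_neg h3, if_neg h1, if_neg h2]
          ring
  simp_rw [key, Finset.sum_add_distrib]
  have hB : (∑ i : Fin N, ∑ j : Fin N, if i.val = j.val + 1 then K.V (x.1 j - x.1 i) else 0) =
      ∑ i : Fin N, ∑ j : Fin N, if j.val = i.val + 1 then K.V (x.1 j - x.1 i) else 0 := by
    rw [Finset.sum_comm]
    refine Finset.sum_congr rfl fun i _ => Finset.sum_congr rfl fun j _ => ?_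
    split_ifs with hji
    · rw [show x.1 i - x.1 j = -(x.1 j - x.1 i) by ring, hV]
    · rfl
  rw [hB]
  ring

/-- **Calibration of the generator at range one.** [folklore] -/
theorem generator_eq_of_range_one (h : K.IsNearestNeighbourAtRangeOne)
    (hV : ∀ r, K.V (-r) = K.V r) (N : ℕ) (T_L T_R : ℝ) (f : PhaseSpace N → ℝ) (x : PhaseSpace N) :
    K.generator N T_L T_R f x = K.toOscillatorChain.generator N T_L T_R f x := by
  have hH : K.hamiltonian N = K.toOscillatorChain.hamiltonian N :=
    funext (hamiltonian_eq_of_range_one h hV N)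
  simp only [generator, OscillatorChain.generator, hH]
  rfl

/-- **Calibration of the currents at range one**: the flux through the cut `(c, c+1)` is the bond
current of the bond `(c, c+1)`. [folklore] -/
theorem cutCurrent_eq_bondCurrent_of_range_one (h : K.IsNearestNeighbourAtRangeOne) (N : ℕ)
    (c : Fin N) (x : PhaseSpace N) :
    K.cutCurrent N c x = K.toOscillatorChain.bondCurrent N c x := by
  unfold cutCurrent OscillatorChain.bondCurrent
  simp only [toOscillatorChain]
  rw [Finset.sum_eq_single c]
  · refine Finset.sum_congr rfl fun j _ => ?_
    by_cases hj : j.val = c.val + 1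
    · have hcj : c.val ≤ c.val ∧ c.val < j.val := ⟨le_rfl, by omega⟩
      have hne : c ≠ j := fun e => by subst e; omega
      rw [if_pos hcj, if_pos hj, kacWeight_of_range_one h hne, if_pos (Or.inl hj), one_mul]
    · rw [if_neg hj]
      split_ifs with hcj
      · have hne : c ≠ j := fun e => by subst e; omega
        rw [kacWeight_of_range_one h hne]
        have : ¬ (j.val = c.val + 1 ∨ c.val = j.val + 1) := by omega
        rw [if_neg this, zero_mul]
      · rfl
  · intro i _ hic
    refine Finset.sum_eq_zero fun j _ => ?_
    split_ifs with hij
    · have hne : i ≠ j := fun e => by subst e; omega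
      rw [kacWeight_of_range_one h hne]
      have hic' : i.val ≠ c.val := fun e => hic (Fin.ext e)
      have : ¬ (j.val = i.val + 1 ∨ i.val = j.val + 1) := by omega
      rw [if_neg this, zero_mul]
    · rfl
  · intro hc
    exact absurd (Finset.mem_univ c) hc

/-- **Fourier's law transfers both ways at range one** (nearest-neighbour kernel, even `V`).
[folklore] -/
theorem fouriersLawFor_iff_of_range_one (h : K.IsNearestNeighbourAtRangeOne)
    (hV : ∀ r, K.V (-r) = K.V r) :
    K.FouriersLawFor ↔ K.toOscillatorChain.FouriersLawFor := by
  have hgen : K.generator = K.toOscillatorChain.generator := by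
    funext N T_L T_R f x
    exact generator_eq_of_range_one h hV N T_L T_R f x
  have hcur : K.cutCurrent = K.toOscillatorChain.bondCurrent := by
    funext N c x
    exact cutCurrent_eq_bondCurrent_of_range_one h N c x
  have hss : K.IsSteadyState = K.toOscillatorChain.IsSteadyState := by
    funext N T_L T_R μ
    simp only [IsSteadyState, OscillatorChain.IsSteadyState, hgen, hcur]
  have htot : ∀ (N : ℕ) (μ : Measure (PhaseSpace N)),
      K.totalCutCurrent μ = K.toOscillatorChain.totalCurrent μ := by
    intro N μ
    simp only [totalCutCurrent, OscillatorChain.totalCurrent, hcur]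
  simp only [FouriersLawFor, OscillatorChain.FouriersLawFor, hss, htot]

end KacOscillatorChain

/-- The FPU-β interaction of `pinnedChain` / `kacPinnedChain` is even. [folklore] -/
theorem kacPinnedChain_V_even (ω₂ lam β γ : ℝ) (φ : ℝ → ℝ) (R : ℕ) (r : ℝ) :
    (kacPinnedChain ω₂ lam β γ φ R).V (-r) = (kacPinnedChain ω₂ lam β γ φ R).V r := by
  simp only [kacPinnedChain]
  ring

/-- **Calibration of the pinned chains**: with a nearest-neighbour kernel at range `R = 1`, Fourier's
law for `kacPinnedChain ω₂ lam β γ φ 1` is Fourier's law for `pinnedChain ω₂ lam β γ`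
(`OscillatorChain.FouriersLawFor`), both ways. [folklore] -/
theorem fouriersLawFor_kacPinnedChain_one_iff (ω₂ lam β γ : ℝ) (φ : ℝ → ℝ)
    (h : (kacPinnedChain ω₂ lam β γ φ 1).IsNearestNeighbourAtRangeOne) :
    (kacPinnedChain ω₂ lam β γ φ 1).FouriersLawFor ↔ (pinnedChain ω₂ lam β γ).FouriersLawFor := by
  rw [KacOscillatorChain.fouriersLawFor_iff_of_range_one h (kacPinnedChain_V_even ω₂ lam β γ φ 1)]
  rfl


end Literature.MathematicalPhysics.KineticTheory.HeatConduction
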